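import Summits.AtomisticToContinuum.FouriersLaw.Theses.JunctionLocality
import Summits.AtomisticToContinuum.FouriersLaw.Theses.ParityLiouvilleSeed

/-!
# Line `balanced-split-concavity-transfer` for crux `JunctionLocality.SuperadditiveResistance`
(stmt-AtomisticToContinuum-11748; shared verbatim by `ParityLiouvilleSeed.SuperadditiveResistance`)

Crux (A): along unique weak-NESS families of `pinnedChain ω₂ lam β γ` (all `> 0`), `T > 0`,
response coefficients `D_N > 0`:  `∃ C, ∀ N M ≥ 2, R_N + R_M − C ≤ R_{N+M}`,
`R_N := (N − 1)/D_N` (end-to-end linear-response resistance).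

THE LINE (idea card `Ideas/balanced-split-concavity-transfer.md`, triage r1: fail / pass / pass,
sharpened here).  The quantifier `∀ N M` hides two different statements; this skeleton separates
them and REPAIRS the odd-length asymmetry flagged by triage r1-3 (2) without any extra hypothesis:

* `stub_evenDoubling` (`Holds.stub_evenDoubling`) — **bounded doubling defect**: `∃ C₁ ∀ N ≥ 2, 2 R_N − C₁ ≤ R_{2N}`.
  This is (A) at the ONE split `N = M` of an EVEN chain, where the `2N`-chain carries the exact
  reflection symmetry `i ↦ 2N−1−i, δ ↦ −δ` (odd first-order response density, junction pair at
  relative temperature `0`, every reflection-even junction observable silent at first order) —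
  the hypothesis under which the sibling device lines' junction engines are valid (triage r1-2/3:
  `S2` of `thermalise-then-cut` is FALSE off balance).  It is exactly the kill statistic of the
  standing Disproof §2 (`2R_N − R_{2N}` bounded) and strictly weaker than (A)
  (`doubling_not_sufficient` below: a sequence with doubling defect `≤ 0` violating the crux shape).
* `stub_balancedMaximality` (`Holds.stub_balancedMaximality`) — **diminishing returns over mirror blocks** (the card's BalancedMax):
  `∃ C₂ ∀ L ∀ 2 ≤ M ≤ L/2, R_M + R_{L−M} ≤ R_{⌊L/2⌋} + R_{⌈L/2⌉} + C₂`, equivalently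
  `R_{⌊L/2⌋} − R_M ≥ R_{L−M} − R_{⌈L/2⌉} − C₂`: the resistance gained by growing a chain from
  `M` to `⌊L/2⌋` sites is at least the resistance gained by growing it from `⌈L/2⌉` to `L − M`
  (approximate concavity of `L ↦ R_L` in block form; exact at the harmonic corner and for every
  parallel-Ohmic-channel length law; a four-chain SHAPE statement with no junction in it).
  HONEST PRICE (triage r1-1, r1-2, r1-3): it is NOT implied by (A) (`R_L = L − log₂ L`,
  refuter's `Card4Witness.lean`; `R_L = L + 10 − √L`, triager 2's `Scratch.lean`), its `M = 2`
  instances are shifted dyadic SUBadditivity, and no dynamical engine is named — it is the line's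
  independent bet and its HARDEST stub.  Structural remark (line card §Transfer): any derivation
  of lopsided superadditivity from balanced data must consume an upper bound on the resistance of
  a union, i.e. a subadditivity-type input; the price is intrinsic to the lever, not to the card.

COMPOSITION (sorry-free, pure arithmetic on `R`): `balanced_of_doubling_max` derives the
near-balanced inequality `R_{⌊L/2⌋} + R_{⌈L/2⌉} − (C₁ + C₂/2) ≤ R_L` for ALL `L ≥ 4` — even `L`
directly, odd `L = 2K+1` from doubling at `K` and `K+1` plus BalancedMax at `(4K+2, 2K)`
(midpoint step `R_{2K} + R_{2K+2} ≤ 2R_{2K+1} + C₂`) — so NO odd-length junction (which has no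
exact ℤ₂ symmetry) and NO bounded-increment hypothesis is ever needed; then
`superadditive_of_balanced` (the card's proved transfer) gives all splits with constant
`C₁ + C₂/2 + C₂`.  `SuperadditiveResistance_of` instantiates `R L := ((L:ℝ) − 1)/D L` under the
crux's own quantifier prefix and concludes the route decl BY NAME.

Disproof used (standing `Disproof.lean` of the cdisprove seat, gen 20260815T224245Z, read from its
evidence notes — the evidence store is not mounted in this seat): §1 shell-false
(`…_false_without_` the dynamics): honoured — both stubs carry the full dynamical prefix and each
stub's conclusion is itself false for a general positive `D` (doubling: `R_N = N` odd / `1` even;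
BalancedMax: `R_N = N²`), so the dynamics is used AT BOTH STUBS and the composition is the
dynamics-free remainder; §2/§2b doubling criterion and `slab_doubling_defect_ge`: `stub_evenDoubling`
IS that statistic (its converse direction), the kill profiles `ℓN + a + bN^s`, `+ b log N` violate
`stub_evenDoubling`, not `stub_balancedMaximality`; §2 one-sidedness (subadditive dip satisfies (A)):
this is where the line over-claims — a slowly growing dip violates `stub_balancedMaximality` while
(A) survives (flagged, not hidden); §3 harmonic-corner tightness (`C ≥ 1/fluxLimit`): consistent —
at the corner `2R_N − R_{2N} → R_∞ = 1/fluxLimit`, so `C₁ ≥ 1/fluxLimit` is forced inside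
`stub_evenDoubling`, and `R_N = 1/fluxCoeff_N` is increasing and concave there (BalancedMax with
`C₂ = 0`); §4(iii) `lam = 0` log edge: a `log N` doubling defect violates `stub_evenDoubling` and
leaves `stub_balancedMaximality` intact — the `lam`-dependence is localised in stub 1.  Landed
Negative lemmas under `Theorems/SuperadditiveResistance/Negative/`: none yet (Negative.lean is
evidence awaiting a prover); nothing here instantiates `harmonic_corner_not_superadditive`
(both stubs are `∃ C`).
-/

namespace Summit.AtomisticToContinuum.FouriersLaw.Cruxes.SuperadditiveResistance.BalancedSplitConcavityTransfer

/-! ## Arithmetic of the transfer (proved) -/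

/-- **The card's transfer lemma** (ideator 2, `SketchIdeator2.superadditive_of_balanced`,
re-proved here to keep the line self-contained): near-balanced superadditivity for every total
length `L ≥ 4` plus balanced maximality give superadditivity for ALL splits, constant `C₁ + C₂`.
[folklore] -/
theorem superadditive_of_balanced (R : ℕ → ℝ) (C₁ C₂ : ℝ)
    (hbal : ∀ L : ℕ, 4 ≤ L → R (L / 2) + R (L - L / 2) - C₁ ≤ R L)
    (hmax : ∀ L M : ℕ, 2 ≤ M → 2 * M ≤ L → R M + R (L - M) ≤ R (L / 2) + R (L - L / 2) + C₂) :
    ∀ N M : ℕ, 2 ≤ N → 2 ≤ M → R N + R M - (C₁ + C₂) ≤ R (N + M) := by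
  suffices key : ∀ N M : ℕ, 2 ≤ N → 2 ≤ M → M ≤ N → R N + R M - (C₁ + C₂) ≤ R (N + M) by
    intro N M hN hM
    rcases le_total M N with h | h
    · exact key N M hN hM h
    · have := key M N hM hN h
      rw [Nat.add_comm] at this
      linarith
  intro N M hN hM hMN
  have hL : 4 ≤ N + M := by omega
  have h2M : 2 * M ≤ N + M := by omega
  have hsub : N + M - M = N := by omega
  have h1 := hmax (N + M) M hM h2M
  rw [hsub] at h1
  have h2 := hbal (N + M) hL
  linarith

/-- `C₂ ≥ 0` is forced by balanced maximality at the balanced split of `L = 4`. [folklore] -/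
theorem nonneg_of_balancedMax (R : ℕ → ℝ) (C₂ : ℝ)
    (hmax : ∀ L M : ℕ, 2 ≤ M → 2 * M ≤ L → R M + R (L - M) ≤ R (L / 2) + R (L - L / 2) + C₂) :
    0 ≤ C₂ := by
  have h := hmax 4 2 (le_refl 2) (by norm_num)
  norm_num at h
  linarith

/-- **Odd-length repair (this seat's sharpening of triage r1-3 (2)).**  Bounded doubling defect
(even totals only, exact ℤ₂-symmetric junction) plus balanced maximality already give the
near-balanced inequality for EVERY total length `L ≥ 4`: for odd `L = 2K+1`, doubling at `K` and
`K+1` and the midpoint instance `R_{2K} + R_{2K+2} ≤ 2 R_{2K+1} + C₂` of balanced maximality at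
`(4K+2, 2K)` combine to `R_K + R_{K+1} − (C₁ + C₂/2) ≤ R_{2K+1}`.  No bounded-increment hypothesis
and no odd-length junction analysis is needed. [folklore] -/
theorem balanced_of_doubling_max (R : ℕ → ℝ) (C₁ C₂ : ℝ)
    (hdbl : ∀ N : ℕ, 2 ≤ N → 2 * R N - C₁ ≤ R (2 * N))
    (hmax : ∀ L M : ℕ, 2 ≤ M → 2 * M ≤ L → R M + R (L - M) ≤ R (L / 2) + R (L - L / 2) + C₂) :
    ∀ L : ℕ, 4 ≤ L → R (L / 2) + R (L - L / 2) - (C₁ + C₂ / 2) ≤ R L := by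
  have hC₂ : 0 ≤ C₂ := nonneg_of_balancedMax R C₂ hmax
  intro L hL
  obtain ⟨K, rfl | rfl⟩ := Nat.even_or_odd' L
  · -- even total `L = 2K`: the doubling inequality itself
    have hK : 2 ≤ K := by omega
    have e1 : 2 * K / 2 = K := by omega
    have e2 : 2 * K - K = K := by omega
    rw [e1, e2]
    have h := hdbl K hK
    linarith
  · -- odd total `L = 2K+1`: doubling at `K`, `K+1` and the midpoint instance of `hmax`
    have hK : 2 ≤ K := by omega
    have e1 : (2 * K + 1) / 2 = K := by omega
    have e2 : 2 * K + 1 - K = K + 1 := by omega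
    rw [e1, e2]
    have h3 := hmax (4 * K + 2) (2 * K) (by omega) (by omega)
    have e3 : (4 * K + 2) / 2 = 2 * K + 1 := by omega
    have e4 : 4 * K + 2 - 2 * K = 2 * K + 2 := by omega
    have e5 : 4 * K + 2 - (2 * K + 1) = 2 * K + 1 := by omega
    rw [e3, e4, e5] at h3
    have h4 := hdbl K hK
    have h5 := hdbl (K + 1) (by omega)
    have e6 : 2 * (K + 1) = 2 * K + 2 := by ring
    rw [e6] at h5
    linarith

/-- **The line's arithmetic in one statement**: bounded doubling defect + balanced maximality ⇒
superadditivity for all splits `N, M ≥ 2`, constant `C₁ + C₂/2 + C₂`. [folklore] -/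
theorem superadditive_of_doubling_max (R : ℕ → ℝ) (C₁ C₂ : ℝ)
    (hdbl : ∀ N : ℕ, 2 ≤ N → 2 * R N - C₁ ≤ R (2 * N))
    (hmax : ∀ L M : ℕ, 2 ≤ M → 2 * M ≤ L → R M + R (L - M) ≤ R (L / 2) + R (L - L / 2) + C₂) :
    ∀ N M : ℕ, 2 ≤ N → 2 ≤ M → R N + R M - (C₁ + C₂ / 2 + C₂) ≤ R (N + M) := by
  have hbal := balanced_of_doubling_max R C₁ C₂ hdbl hmax
  have h := superadditive_of_balanced R (C₁ + C₂ / 2) C₂ hbal hmax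
  intro N M hN hM
  have := h N M hN hM
  linarith

/-- **Stub 2 is load-bearing** (answer to the shred/costume reading "all difficulty sits in the
doubling stub"): bounded — here even nonpositive — doubling defect alone does NOT give the crux
shape.  Witness `R L = L` for even `L`, `0` for odd `L`: `2 R_N − R_{2N} ≤ 0` for all `N`, yet
`R_3 + R_M − R_{M+3} = M` for even `M`. [folklore] -/
theorem doubling_not_sufficient :
    ∃ R : ℕ → ℝ, (∀ N : ℕ, 2 ≤ N → 2 * R N - 0 ≤ R (2 * N)) ∧
      ¬ ∃ C : ℝ, ∀ N M : ℕ, 2 ≤ N → 2 ≤ M → R N + R M - C ≤ R (N + M) := by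
  refine ⟨fun L => if Even L then (L : ℝ) else 0, ?_, ?_⟩
  · intro N hN
    have h2N : Even (2 * N) := even_two_mul N
    by_cases hN' : Even N
    · simp only [hN', h2N, if_true]
      push_cast
      linarith
    · simp [hN', h2N]
  · rintro ⟨C, hC⟩
    -- take N = 3 (odd) and M even and large: R 3 + R M - R (M + 3) = M
    obtain ⟨k, hk⟩ := exists_nat_gt (max C 2)
    have hk2 : 2 ≤ 2 * k := by
      have : (2 : ℝ) < k := lt_of_le_of_lt (le_max_right _ _) hk
      have : (2 : ℕ) < k := by exact_mod_cast this
      omega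
    have h := hC 3 (2 * k) (by norm_num) hk2
    have h3 : ¬ Even 3 := by decide
    have hM : Even (2 * k) := even_two_mul k
    have hS : ¬ Even (3 + 2 * k) := by
      rw [Nat.even_add]
      simp [h3, hM]
    simp only [h3, hM, hS, if_true, if_false] at h
    push_cast at h
    have hCk : C < k := lt_of_le_of_lt (le_max_left _ _) hk
    linarith

/-! ## Registered stubs

Shape (D-0027 §3.3, as in `Lines/median-sheet-isoperimetric-isotopy`, `Lines/entropy-ratchet`): each stub is a
sorried theorem `Holds.stub_<name> : <full statement> := by sorry` — `ledger skeleton check` registers it under the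
name `stub_<name>` with THAT statement text as its signature — plus the by-name handle
`def stub_<name> : Prop := type_of% Holds.stub_<name>` which the layer-invariant audit (`#h21_check_skeleton`)
requires of the hypotheses of `SuperadditiveResistance_of` (seats cannot apply `@[stub]`; the gate stamps it).
Both statements carry the crux's own quantifier prefix verbatim (route file `Theses/JunctionLocality.lean`), so
that `R L := ((L:ℝ) − 1)/D L` unfolds to their atoms definitionally. -/

/-- **Stub 1 — EvenDoubling (bounded doubling defect at the reflection-symmetric junction; load-bearing
interface to the device lines; size XL).**  Under the crux's hypotheses (weak-NESS uniqueness, a steady-state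
family of `pinnedChain ω₂ lam β γ`, `T > 0`, response coefficients `D` with `D_N > 0` for `N ≥ 2`):
`∃ C₁ ∀ N ≥ 2, 2 R_N − C₁ ≤ R_{2N}`, `R_N = (N−1)/D_N`, i.e. cutting the `2N`-chain at its CENTRAL bond and
re-thermalising both new ends raises the end-to-end resistance by at most `C₁`.  The `2N`-chain driven at
`T ± δ/2` is mapped to itself by `(i ↦ 2N−1−i, δ ↦ −δ)`; by uniqueness the first-order response density is
reflection-ODD, the junction pair `{N−1, N}` sits at first-order temperature exactly `T`, and every
reflection-even junction observable has zero first-order response — the regime in which the device lines'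
engines (`thermalise-then-cut-probe-insertion` (★)+S2+S3, `floating-probe` parity leg, `double-escape` TL⁺/FT at
`N = M`) are designed to work (triage r1-2/r1-3: S2 is false off balance).  Kinetic caricature (Disproof §2b
`slab_doubling_defect_ge`): `2R_N − R_{2N} ≥ Σ_{ℓ_m ≤ N} w_m ℓ_m²/(3κ²)`, so the stub ⇔ finite mfp second moment —
true for `lam > 0` (on-site vertex, `ν(0) > 0`), log-divergent at the `lam = 0` edge (outside the box).  Harmonic
corner: holds with the FORCED constant `C₁ = 1/fluxLimit ω₂ γ` (Disproof §3; toy j007741 reproduces `8 = 1/fluxLimit 1 1`).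
Strictly weaker than the crux (`doubling_not_sufficient`; log-periodic laws `L(1 + ε cos(2π log₂ L))`). -/
theorem Holds.stub_evenDoubling :
    ∀ ω₂ lam β γ : ℝ, 0 < ω₂ → 0 < lam → 0 < β → 0 < γ →
    (∀ (N : ℕ) (T_L T_R : ℝ), 0 < T_L → 0 < T_R →
      ∀ μ ν : MeasureTheory.Measure (Literature.MathematicalPhysics.KineticTheory.HeatConduction.PhaseSpace N),
        (Literature.MathematicalPhysics.KineticTheory.HeatConduction.pinnedChain ω₂ lam β γ).IsSteadyState N T_L T_R μ →
        (Literature.MathematicalPhysics.KineticTheory.HeatConduction.pinnedChain ω₂ lam β γ).IsSteadyState N T_L T_R ν →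
        μ = ν) →
    ∀ μ : (N : ℕ) → ℝ → ℝ →
        MeasureTheory.Measure (Literature.MathematicalPhysics.KineticTheory.HeatConduction.PhaseSpace N),
    (∀ (N : ℕ) (T_L T_R : ℝ), 0 < T_L → 0 < T_R →
      (Literature.MathematicalPhysics.KineticTheory.HeatConduction.pinnedChain ω₂ lam β γ).IsSteadyState N T_L T_R
        (μ N T_L T_R)) →
    ∀ T : ℝ, 0 < T → ∀ D : ℕ → ℝ,
    (∀ N : ℕ, Filter.Tendsto (fun δ : ℝ =>
        (Literature.MathematicalPhysics.KineticTheory.HeatConduction.pinnedChain ω₂ lam β γ).totalCurrent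
          (μ N (T + δ / 2) (T - δ / 2)) / δ) (nhdsWithin 0 {(0 : ℝ)}ᶜ) (nhds (D N))) →
    (∀ N : ℕ, 2 ≤ N → 0 < D N) →
    ∃ C₁ : ℝ, ∀ N : ℕ, 2 ≤ N →
      2 * (((N : ℝ) - 1) / D N) - C₁ ≤ (((2 * N : ℕ) : ℝ) - 1) / D (2 * N) := by
  sorry

/-- **Stub 2 — BalancedMaximality (diminishing returns over mirror blocks; the card's BalancedMax; HARDEST, the
line's independent bet; size XL / no engine).**  Under the same hypotheses: `∃ C₂ ∀ L M, 2 ≤ M → 2M ≤ L →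
R_M + R_{L−M} ≤ R_{⌊L/2⌋} + R_{⌈L/2⌉} + C₂` — among the two-piece partitions of `L` sites the balanced one has
(up to `C₂`) the largest total resistance; equivalently `R_{⌊L/2⌋} − R_M ≥ R_{L−M} − R_{⌈L/2⌉} − C₂` (growing a
chain by the same number of sites costs no more resistance when the chain is longer).  A four-chain SHAPE
statement about the single-chain length law, no junction in it.  Follows from summably-almost-nonincreasing
increments `r_L = R_{L+1} − R_L` (approximate concavity of `L ↦ R_L`); EXACT (`C₂ = 0`) at the harmonic corner
(`R_N = 1/fluxCoeff_N` increasing concave, `fluxCoeff_eq`), for every parallel-channel length law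
`R_L = 1/Σ_m a_m/(L + ℓ_m)` (Cauchy–Schwarz) — ballistic, diffusive AND anomalous kinetic laws — and in the exact
flip-noise proxy (toy j007741: `max BM ≤ 2e-9`, `R_L` concave to solver precision); FAILS for convex (insulating)
`R`, for a slowly growing subadditive dip below the bulk line (`R_L = L/κ + a − b log L`, `− bL^s`: worlds where
(A) still holds — refuter's `Card4Witness.lean`, triager 2's `Scratch.lean`) and for log-periodic modulations of
the linear law.  Its `M = 2` instances read `R_{L−2} + R_2 ≤ R_{⌊L/2⌋} + R_{⌈L/2⌉} + C₂` (shifted dyadic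
subadditivity): the stub is of SUBadditive type and is NOT implied by the crux (honest price, triage r1-1/2/3);
candidate engines: a diminishing-marginal-resistance comparison for one-block insertions, or inheritance of the
concave slab shape from the kinetic (phonon-Boltzmann) limit. -/
theorem Holds.stub_balancedMaximality :
    ∀ ω₂ lam β γ : ℝ, 0 < ω₂ → 0 < lam → 0 < β → 0 < γ →
    (∀ (N : ℕ) (T_L T_R : ℝ), 0 < T_L → 0 < T_R →
      ∀ μ ν : MeasureTheory.Measure (Literature.MathematicalPhysics.KineticTheory.HeatConduction.PhaseSpace N),
        (Literature.MathematicalPhysics.KineticTheory.HeatConduction.pinnedChain ω₂ lam β γ).IsSteadyState N T_L T_R μ →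
        (Literature.MathematicalPhysics.KineticTheory.HeatConduction.pinnedChain ω₂ lam β γ).IsSteadyState N T_L T_R ν →
        μ = ν) →
    ∀ μ : (N : ℕ) → ℝ → ℝ →
        MeasureTheory.Measure (Literature.MathematicalPhysics.KineticTheory.HeatConduction.PhaseSpace N),
    (∀ (N : ℕ) (T_L T_R : ℝ), 0 < T_L → 0 < T_R →
      (Literature.MathematicalPhysics.KineticTheory.HeatConduction.pinnedChain ω₂ lam β γ).IsSteadyState N T_L T_R
        (μ N T_L T_R)) →
    ∀ T : ℝ, 0 < T → ∀ D : ℕ → ℝ,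
    (∀ N : ℕ, Filter.Tendsto (fun δ : ℝ =>
        (Literature.MathematicalPhysics.KineticTheory.HeatConduction.pinnedChain ω₂ lam β γ).totalCurrent
          (μ N (T + δ / 2) (T - δ / 2)) / δ) (nhdsWithin 0 {(0 : ℝ)}ᶜ) (nhds (D N))) →
    (∀ N : ℕ, 2 ≤ N → 0 < D N) →
    ∃ C₂ : ℝ, ∀ L M : ℕ, 2 ≤ M → 2 * M ≤ L →
      ((M : ℝ) - 1) / D M + (((L - M : ℕ) : ℝ) - 1) / D (L - M) ≤
        (((L / 2 : ℕ) : ℝ) - 1) / D (L / 2) + (((L - L / 2 : ℕ) : ℝ) - 1) / D (L - L / 2) + C₂ := by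
  sorry

/-! ### By-name handles of the two statements (no second copy of the text) -/

/-- Statement of registered stub 1 (`Holds.stub_evenDoubling`), by name. -/
def stub_evenDoubling : Prop := type_of% Holds.stub_evenDoubling

/-- Statement of registered stub 2 (`Holds.stub_balancedMaximality`), by name. -/
def stub_balancedMaximality : Prop := type_of% Holds.stub_balancedMaximality

/-! ## Composition (sorry-free): the two stubs give the crux BY NAME -/

/-- **`stub_evenDoubling → stub_balancedMaximality → JunctionLocality.SuperadditiveResistance`**
(kernel-checked; constant `C = C₁ + C₂/2 + C₂`): instantiate `superadditive_of_doubling_max`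
at `R L := ((L:ℝ) − 1)/D L` under the crux's quantifier prefix. [folklore] -/
theorem SuperadditiveResistance_of (hdbl : stub_evenDoubling) (hmax : stub_balancedMaximality) :
    Summit.AtomisticToContinuum.FouriersLaw.Theses.JunctionLocality.SuperadditiveResistance := by
  intro ω₂ lam β γ hω hl hβ hγ huniq μ hμ T hT D hD hpos
  obtain ⟨C₁, h1⟩ := hdbl ω₂ lam β γ hω hl hβ hγ huniq μ hμ T hT D hD hpos
  obtain ⟨C₂, h2⟩ := hmax ω₂ lam β γ hω hl hβ hγ huniq μ hμ T hT D hD hpos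
  refine ⟨C₁ + C₂ / 2 + C₂, fun N M hN hM => ?_⟩
  have key := superadditive_of_doubling_max (fun L : ℕ => ((L : ℝ) - 1) / D L) C₁ C₂
    (fun N hN => h1 N hN) (fun L M hM hML => h2 L M hM hML) N M hN hM
  simpa [Nat.cast_add] using key

/-- The shared twin: the `ParityLiouvilleSeed` copy of the crux (route
`route-AtomisticToContinuum-ParityLiouvilleSeed`, rank 6) is the same proposition (verbatim signature;
Disproof §0 `twin_eq` is `rfl`), so the line closes it too, by definitional unfolding. [folklore] -/
theorem SuperadditiveResistance_twin_of (hdbl : stub_evenDoubling) (hmax : stub_balancedMaximality) :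
    Summit.AtomisticToContinuum.FouriersLaw.Theses.ParityLiouvilleSeed.SuperadditiveResistance :=
  SuperadditiveResistance_of hdbl hmax

/-- D-0027 §3.3 shape: the crux from the registered stubs (an `example`, so that `SuperadditiveResistance_of`
stays the unique theorem concluding the crux; it becomes a proof once the two `sorry`s are discharged). -/
example : Summit.AtomisticToContinuum.FouriersLaw.Theses.JunctionLocality.SuperadditiveResistance :=
  SuperadditiveResistance_of Holds.stub_evenDoubling Holds.stub_balancedMaximality

end Summit.AtomisticToContinuum.FouriersLaw.Cruxes.SuperadditiveResistance.BalancedSplitConcavityTransfer
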